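import Mathlib
import HarnessLib

/-!
# ValiantsHypothesis / LacunarySymmetroid — crux `MatrixDescartes` (stmt-ValiantsHypothesis-18050, V1),
# line `Cruxes/MatrixDescartes/Lines/osculation_law.lean` («osculation-law»), stub `stub_peel` at RANK TWO:
# THE TWO BRANCH FORMULAS (step (B4a) of HOME/lmr/NOTE-p7g12-peel-r2-plan.md)

At rank two the spectral curve `a(t) b² + e(t) b + f(t) = 0` (`Δ = e² − 4af ≥ 0` by hyperbolicity) has the two
branches `r_σ = (−e + σ√Δ)/(2a)` (`σ = ±1`) off the poles `a = 0`, and the "citardauq" form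
`ρ_σ = −2f/(e + σ√Δ)`, which agrees with `r_σ` off the poles and continues the REGULAR branch (`σ·e > 0`)
smoothly THROUGH a pole with the value `−f/e`.  Pointwise facts for arbitrary real numbers / polynomials:

* `quad_root_iff` — for `a ≠ 0`, `4af ≤ e²`: `a b² + e b + f = 0 ↔ b = r₊ ∨ b = r₋`;
* `two_mul_r_add` — `2a·r_σ + e = σ√Δ` (`= ∂_bΦ` on the branch); `r_eq_rho` — `r_σ = ρ_σ` when `e + σ√Δ ≠ 0`;
* `rho_at_pole` — at `a = 0` with `σ e > 0`: `ρ_σ = −f/e`;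
* `contDiffAt_r` / `contDiffAt_rho` — smoothness of the two formulas in `t` where `a ≠ 0`, `Δ > 0`, resp.
  `Δ > 0`, `e + σ√Δ ≠ 0` (polynomial coefficients; `Real.sqrt` is smooth off `0`);
* `continuousAt_r` — continuity of `r_σ` where `a ≠ 0` (no sign condition on `Δ`);
* `eventually_eval_ne_zero` — a non-zero polynomial is non-zero on a punctured neighbourhood of any point.

Honest framing: bookkeeping for an OPEN stub; nothing here bears on `stub_peel`, the LAW, `MatrixDescartes` or
`VP ≠ VNP`.  No definitions (the branches are written out as lambda terms), no named facts; Mathlib only.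
-/

-- `Summit.ValiantsHypothesis.ValiantsHypothesis.…` is the tree's mandated single-conjunct layout (Sub = Summit).
set_option linter.dupNamespace false

noncomputable section

namespace Summit.ValiantsHypothesis.ValiantsHypothesis.Theorems.LacunarySymmetroidMatrixDescartes

open Polynomial Set
open scoped BigOperators Topology

namespace OsculationPeel

/-! ### Pointwise algebra of the quadratic -/

/-- **The two roots.**  For `a ≠ 0` and `4af ≤ e²`:
`a b² + e b + f = 0 ↔ b = (−e + √Δ)/(2a) ∨ b = (−e − √Δ)/(2a)`, `Δ = e² − 4af`. [folklore] -/
theorem quad_root_iff {a e f : ℝ} (ha : a ≠ 0) (hΔ : 4 * a * f ≤ e ^ 2) (b : ℝ) :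
    a * b ^ 2 + e * b + f = 0 ↔
      b = (-e + Real.sqrt (e ^ 2 - 4 * a * f)) / (2 * a) ∨ b = (-e - Real.sqrt (e ^ 2 - 4 * a * f)) / (2 * a) := by
  have hs : discrim a e f = Real.sqrt (e ^ 2 - 4 * a * f) * Real.sqrt (e ^ 2 - 4 * a * f) := by
    rw [discrim, Real.mul_self_sqrt (by linarith)]
  have h := quadratic_eq_zero_iff ha hs b
  rw [show a * (b * b) + e * b + f = a * b ^ 2 + e * b + f by ring] at h
  exact h

/-- On the branch `r_σ = (−e + σ√Δ)/(2a)`: `2a·r_σ + e = σ√Δ` (the value of `∂_bΦ`). [folklore] -/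
theorem two_mul_r_add {a e f σ : ℝ} (ha : a ≠ 0) :
    2 * a * ((-e + σ * Real.sqrt (e ^ 2 - 4 * a * f)) / (2 * a)) + e = σ * Real.sqrt (e ^ 2 - 4 * a * f) := by
  field_simp
  ring

/-- `r_σ` is a root: `a r_σ² + e r_σ + f = 0` (`σ = ±1`, `4af ≤ e²`). [folklore] -/
theorem quad_r_eq_zero {a e f σ : ℝ} (ha : a ≠ 0) (hΔ : 4 * a * f ≤ e ^ 2) (hσ : σ = 1 ∨ σ = -1) :
    a * ((-e + σ * Real.sqrt (e ^ 2 - 4 * a * f)) / (2 * a)) ^ 2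
      + e * ((-e + σ * Real.sqrt (e ^ 2 - 4 * a * f)) / (2 * a)) + f = 0 := by
  rw [quad_root_iff ha hΔ]
  rcases hσ with rfl | rfl
  · left; ring
  · right; ring

/-- **`r_σ = ρ_σ`**: `(−e + σ√Δ)/(2a) = −2f/(e + σ√Δ)` whenever `a ≠ 0`, `e + σ√Δ ≠ 0` (`σ = ±1`, `4af ≤ e²`;
from `(σ√Δ)² − e² = −4af`). [folklore] -/
theorem r_eq_rho {a e f σ : ℝ} (ha : a ≠ 0) (hΔ : 4 * a * f ≤ e ^ 2) (hσ : σ = 1 ∨ σ = -1)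
    (hden : e + σ * Real.sqrt (e ^ 2 - 4 * a * f) ≠ 0) :
    (-e + σ * Real.sqrt (e ^ 2 - 4 * a * f)) / (2 * a) = -2 * f / (e + σ * Real.sqrt (e ^ 2 - 4 * a * f)) := by
  have hσ2 : σ ^ 2 = 1 := by rcases hσ with rfl | rfl <;> norm_num
  have hsq : Real.sqrt (e ^ 2 - 4 * a * f) ^ 2 = e ^ 2 - 4 * a * f := Real.sq_sqrt (by linarith)
  rw [div_eq_div_iff (mul_ne_zero two_ne_zero ha) hden]
  have : (-e + σ * Real.sqrt (e ^ 2 - 4 * a * f)) * (e + σ * Real.sqrt (e ^ 2 - 4 * a * f)) =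
      σ ^ 2 * Real.sqrt (e ^ 2 - 4 * a * f) ^ 2 - e ^ 2 := by ring
  rw [this, hσ2, hsq]
  ring

/-- **At a pole the citardauq form is regular**: `a = 0`, `σ·e > 0` (`σ = ±1`) ⇒ `−2f/(e + σ√Δ) = −f/e` (here
`√Δ = |e| = σ e`). [folklore] -/
theorem rho_at_pole {a e f σ : ℝ} (ha : a = 0) (hσ : σ = 1 ∨ σ = -1) (hσe : 0 < σ * e) :
    -2 * f / (e + σ * Real.sqrt (e ^ 2 - 4 * a * f)) = -f / e := by
  have he : e ≠ 0 := by rintro rfl; simp at hσe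
  have hsqrt : Real.sqrt (e ^ 2 - 4 * a * f) = |e| := by rw [ha]; simp [Real.sqrt_sq_eq_abs]
  have hσabs : σ * |e| = e := by
    rcases hσ with rfl | rfl
    · rw [one_mul] at hσe ⊢; exact abs_of_pos hσe
    · have : e < 0 := by linarith
      rw [abs_of_neg this]; ring
  rw [hsqrt, hσabs, div_eq_div_iff (by intro h; apply he; linarith) he]
  ring

/-! ### Smoothness of the two formulas in `t` -/

/-- Polynomial evaluation is smooth. [folklore] -/
theorem contDiffAt_eval (p : ℝ[X]) (t : ℝ) : ContDiffAt ℝ ⊤ (fun s => p.eval s) t := by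
  have h := (Polynomial.contDiff_aeval (𝕜 := ℝ) p ⊤).contDiffAt (x := t)
  have hfun : (fun x : ℝ => p.aeval x) = fun s => p.eval s := by
    funext x; exact congrFun (Polynomial.coe_aeval_eq_eval x) p
  rwa [hfun] at h

/-- **`r_σ` is smooth at `t`** when `a(t) ≠ 0` and `Δ(t) > 0`. [folklore] -/
theorem contDiffAt_r (a e f : ℝ[X]) (σ t : ℝ) (ha : a.eval t ≠ 0)
    (hΔ : 0 < e.eval t ^ 2 - 4 * a.eval t * f.eval t) :
    ContDiffAt ℝ ⊤ (fun s => (-e.eval s + σ * Real.sqrt (e.eval s ^ 2 - 4 * a.eval s * f.eval s)) / (2 * a.eval s)) t := by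
  have hD : ContDiffAt ℝ ⊤ (fun s => e.eval s ^ 2 - 4 * a.eval s * f.eval s) t :=
    ((contDiffAt_eval e t).pow 2).sub ((contDiffAt_const.mul (contDiffAt_eval a t)).mul (contDiffAt_eval f t))
  have hsqrt : ContDiffAt ℝ ⊤ (fun s => Real.sqrt (e.eval s ^ 2 - 4 * a.eval s * f.eval s)) t :=
    (Real.contDiffAt_sqrt hΔ.ne').comp t hD
  exact ((contDiffAt_eval e t).neg.add (contDiffAt_const.mul hsqrt)).div
    (contDiffAt_const.mul (contDiffAt_eval a t)) (mul_ne_zero two_ne_zero ha)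

/-- **`ρ_σ` is smooth at `t`** when `Δ(t) > 0` and `e(t) + σ√Δ(t) ≠ 0` (in particular at a regular pole).
[folklore] -/
theorem contDiffAt_rho (a e f : ℝ[X]) (σ t : ℝ) (hΔ : 0 < e.eval t ^ 2 - 4 * a.eval t * f.eval t)
    (hden : e.eval t + σ * Real.sqrt (e.eval t ^ 2 - 4 * a.eval t * f.eval t) ≠ 0) :
    ContDiffAt ℝ ⊤ (fun s => -2 * f.eval s / (e.eval s + σ * Real.sqrt (e.eval s ^ 2 - 4 * a.eval s * f.eval s))) t := by
  have hD : ContDiffAt ℝ ⊤ (fun s => e.eval s ^ 2 - 4 * a.eval s * f.eval s) t :=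
    ((contDiffAt_eval e t).pow 2).sub ((contDiffAt_const.mul (contDiffAt_eval a t)).mul (contDiffAt_eval f t))
  have hsqrt : ContDiffAt ℝ ⊤ (fun s => Real.sqrt (e.eval s ^ 2 - 4 * a.eval s * f.eval s)) t :=
    (Real.contDiffAt_sqrt hΔ.ne').comp t hD
  exact (contDiffAt_const.mul (contDiffAt_eval f t)).div ((contDiffAt_eval e t).add (contDiffAt_const.mul hsqrt)) hden

/-- **`r_σ` is continuous at `t`** whenever `a(t) ≠ 0` (no condition on `Δ`: `√` is continuous). [folklore] -/
theorem continuousAt_r (a e f : ℝ[X]) (σ t : ℝ) (ha : a.eval t ≠ 0) :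
    ContinuousAt (fun s => (-e.eval s + σ * Real.sqrt (e.eval s ^ 2 - 4 * a.eval s * f.eval s)) / (2 * a.eval s)) t := by
  have hD : ContinuousAt (fun s => e.eval s ^ 2 - 4 * a.eval s * f.eval s) t :=
    ((e.continuous.pow 2).sub ((continuous_const.mul a.continuous).mul f.continuous)).continuousAt
  have hsqrt : ContinuousAt (fun s => Real.sqrt (e.eval s ^ 2 - 4 * a.eval s * f.eval s)) t :=
    Real.continuous_sqrt.continuousAt.comp hD
  exact (e.continuous.continuousAt.neg.add (continuousAt_const.mul hsqrt)).div
    (continuousAt_const.mul a.continuous.continuousAt) (mul_ne_zero two_ne_zero ha)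

/-- **Isolated zeros**: a non-zero polynomial does not vanish on a punctured neighbourhood of `t₀`. [folklore] -/
theorem eventually_eval_ne_zero (p : ℝ[X]) (hp : p ≠ 0) (t₀ : ℝ) :
    ∀ᶠ t in 𝓝 t₀, t ≠ t₀ → p.eval t ≠ 0 := by
  classical
  have hfin : ((p.roots.toFinset.erase t₀ : Finset ℝ) : Set ℝ).Finite := Finset.finite_toSet _
  have hopen : IsOpen (((p.roots.toFinset.erase t₀ : Finset ℝ) : Set ℝ)ᶜ) := hfin.isClosed.isOpen_compl
  have hmem : t₀ ∈ (((p.roots.toFinset.erase t₀ : Finset ℝ) : Set ℝ)ᶜ) := by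
    simp
  filter_upwards [hopen.mem_nhds hmem] with t ht hne hzero
  exact ht (Finset.mem_coe.2 (Finset.mem_erase.2 ⟨hne, Multiset.mem_toFinset.2 ((mem_roots hp).2 hzero)⟩))

end OsculationPeel

end Summit.ValiantsHypothesis.ValiantsHypothesis.Theorems.LacunarySymmetroidMatrixDescartes

end
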